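import Summits.AtomisticToContinuum.HydrodynamicLimit.Theses.LambertianContactSwap
import Summits.AtomisticToContinuum.HydrodynamicLimit.Theses.LindebergRandomFuture
import Summits.AtomisticToContinuum.HydrodynamicLimit.Theses.VanishingNoise
import Summits.AtomisticToContinuum.HydrodynamicLimit.Theorems.LambertianContactSwapSwapGapOfHydrodynamicLimit
import Summits.AtomisticToContinuum.HydrodynamicLimit.Theorems.LambertianContactSwapLocalGibbsProbability
import Literature.MathematicalPhysics.KineticTheory.HardSphereEulerProofs
import HarnessLib

/-!
# Line `dice-transfer` for crux `LambertianContactSwap.SwapGap` (stmt-AtomisticToContinuum-11850) — ALTERNATIVE skeleton (crux-strategist s2)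

planner-cstrat-stmt-AtomisticToContinuum-11850-s2-0, 2026-08-17.  Direction: POSITIVE.  `SwapGap_of` / `swapGap_of_stubs` /
`SwapGap_proof` conclude the crux decl `Summit.AtomisticToContinuum.HydrodynamicLimit.Theses.LambertianContactSwap.SwapGap`
(and its byte-identical copy `…Theses.LindebergRandomFuture.SwapGap`) BY NAME from the three registered stubs, which carry
the only `sorry`s of the file; the 150-line transfer `hydrodynamicLimit_unguarded_of_dice` is PROVED here (standard axioms).

THE LINE (census §D5/§T7; the in-tree sibling of the derandomisation step).  Deform the deterministic gas `Φ` INSIDE THE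
COLLISION: the dice gas `dflow(q)` of route `VanishingNoise` redraws a fraction `q` of the real collisions with the Lambertian
cosine law and keeps the rest specular (`q = 0` is `Φ`; pair momentum / energy, Liouville and every Gibbs law are preserved for
every `q`).  Then
  `E F(fields Φ_t) − E F(fields Λ_t) = [E F(Φ_t) − E F(dice(q_N)_t)] + [E F(dice(q_N)_t) − F(Euler_t)] − [E F(Λ_t) − F(Euler_t)]`
along the schedule `q_N := (N+1)^{-1/6}` (`q_N → 0`, `q_N (N+1)^{1/3} → ∞`):
* stub D1 `stub_diceContinuity`  = item stmt-8723 `VanishingNoise.DiceContinuity` (law-level continuity of the `χ`-tested field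
  laws at zero dice fraction, uniformly in `N`, along EVERY schedule `q_N → 0`) kills the first bracket — ITS engine is the Russo
  influence budget `CoinInfluence` (stmt-8724): the deterministic gas is asked for a BOUND (summed law-level influence of single
  re-randomised collisions `O(1)`), never for a contact-statistics equidistribution or a cancellation, because `q_N → 0` pays;
* stub D2 `stub_rareDiceEuler`    = item stmt-8722 `VanishingNoise.RareDiceEuler` (Olla–Varadhan–Yau in OVY's own weak-noise
  regime `θ → ∞`, `εθ → 0`: a vanishing FRACTION of randomised collisions, `q_N (N+1)^{1/3} → ∞` of them per particle) kills the
  second bracket IN PROBABILITY — no speed-`N` large deviations are asked of any gas (contrast S2 of line `Sketch`);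
* stub D3 `stub_lambertianEuler`  = this route's crux #3, item stmt-11854 `LambertianEuler` (in probability), kills the third.
The portmanteau algebra (bounded-Lipschitz cut-offs, Markov lower bound on the measurable deterministic side, measurability-free
upper bound on the dice side, `P_N` a probability law for `σ ≤ 1/2`) is `hydrodynamicLimit_unguarded_of_dice` — the tactic body of
`VanishingNoise.closes` as certified 2026-08-16T06:08Z, whose conclusion was (pre-D-0032) exactly the UNGUARDED Literature
conjunct — followed by the landed `Theorems.swapGap_of_hydrodynamicLimit` (with `localGibbsProbability_proof` and D3).

HONEST STATUS.  At summit level the line is DOMINATED by route `VanishingNoise` itself (D1 ∧ D2 already decide the conjunct, without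
`Λ`); for THIS crux it is the one closing skeleton on the board whose deterministic-side obligation is a no-cancellation bound and
whose random-side obligations are in-probability Euler limits only.  It does not touch the live line `Sketch` (entropy relative to
`Λ`'s law; stuck stubs S1 `stub_relEntSwap` conjunct-strength, S2 speed-`N` LD for `Λ`, S1ʳ′, S2ʳ): no entropy, no LD, no contact
trace, no echo.  Route `VanishingNoise` is currently BLOCKED on stale hygiene lints (needs_repair 2026-08-15T14:17Z: crux-floor /
why-sources on a superseded informal support) and its tree file predates the D-0032 re-type (its `closes` still `intro`s the
unguarded prefix) — flagged to the reconciler / tenure planner in the census; items 8722–8724 are typed, grounded and unrefuted.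

NOT skeleton-registered by this seat: `ledger skeleton check` has no `--alt` switch and would overwrite the live lead's registered
skeleton (`Lines/Sketch.lean` v15, four research stubs); published as `Lines/dice-transfer.lean` + `Lines/dice-transfer.md` and
attached as evidence for the continuation lead, who may register it at a cycle boundary.
-/

noncomputable section

namespace Summit.AtomisticToContinuum.HydrodynamicLimit.Cruxes.SwapGap.DiceTransfer

open scoped BigOperators Topology Classical MeasureTheory ProbabilityTheory ENNReal
open Filter Set Function MeasureTheory
open Summit.AtomisticToContinuum.HydrodynamicLimit.Theses

/-! ## §1 The registered stubs (the only `sorry`s) -/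

/-- **D1 — law-level continuity at zero dice fraction** (= item stmt-AtomisticToContinuum-8723, `VanishingNoise.DiceContinuity`,
crux rank 2 of route `VanishingNoise`; the HARDEST stub).  For bounded `1`-Lipschitz functionals of the three `χ`-tested fields,
`E_{P_N} F(fields Φ_t) − E_{P_N ⊗ noise(q_N)} F(fields dflow_t) → 0` along every schedule `q_N → 0`, pre-shock.  Engine foreseen by
that route: `CoinInfluence` (stmt-8724, Russo budget `Σ_k |E[F | coin_k := heads] − E[F | coin_k := tails]| ≤ C` uniformly in
`N ≥ N₀`, `q ≤ q₀`, horizon `K`) integrates to `|Δ_N(q)| ≤ C q`. Exact at `q_N ≡ 0` (`DiceAtZero`, stmt-8691). -/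
theorem stub_diceContinuity : VanishingNoise.DiceContinuity := by
  sorry

/-- **D2 — Euler for the dice gas at a vanishing fraction of randomised collisions** (= item stmt-AtomisticToContinuum-8722,
`VanishingNoise.RareDiceEuler`, crux rank 3 of route `VanishingNoise`): for every schedule `q_N → 0` with `q_N (N+1)^{1/3} → ∞`,
convergence IN PROBABILITY of the `χ`-tested density / momentum / energy fields of `dflow_t` to the classical hs-Euler values,
pre-shock, from local Gibbs data (OllaVaradhanYau1993 Thm 2.1 / Cor. 2.2 in their regime `θ → ∞`, `εθ → 0`, p. 527). -/
theorem stub_rareDiceEuler : VanishingNoise.RareDiceEuler := by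
  sorry

/-- **D3 — Euler for the Lambertian gas, in probability** (= item stmt-AtomisticToContinuum-11854, this route's crux #3
`LambertianContactSwap.LambertianEuler`; delegated to its own line). -/
theorem stub_lambertianEuler : LambertianContactSwap.LambertianEuler := by
  sorry

/-! ## §2 The transfer (proved): dice cruxes ⟹ the UNGUARDED hydrodynamic limit of the deterministic gas -/

set_option maxHeartbeats 1600000 in
/-- **D1 ∧ D2 ⟹ `Literature.MathematicalPhysics.KineticTheory.HydrodynamicLimit` (unguarded).**  Portmanteau along
`q_N := (N+1)^{-1/6}`: per field and `δ > 0`, with the `1`-Lipschitz cut-off `min 1 (max 0 (dev − δ/2))`,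
`min(1,δ/2)·P_N{δ < dev(Φ_t)} ≤ E_{P_N}[cut-off ∘ Φ_t]` (Markov; `P_N` is a probability law for `σ ≤ 1/2`, fields measurable),
`= E_{P_N ⊗ noise(q_N)}[cut-off ∘ dflow_t] + o(1)` (D1), `≤ (P_N ⊗ noise(q_N)){δ/2 < dev(dflow_t)} + o(1)` (measurability-free:
`ofReal ∫ ≤ ∫⁻ ofReal ≤` measure of the set) `→ 0` (D2).  Verbatim the tactic body of `VanishingNoise.closes` (certified
2026-08-16T06:08Z, standard axioms), whose conclusion was this statement before the D-0032 re-type. -/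
theorem hydrodynamicLimit_unguarded_of_dice (h₁ : VanishingNoise.DiceContinuity) (h₂ : VanishingNoise.RareDiceEuler) :
    Literature.MathematicalPhysics.KineticTheory.HydrodynamicLimit := by
  have key : ∀ {X Y : ℕ → Type} [∀ N, MeasurableSpace (X N)] [∀ N, MeasurableSpace (Y N)]
      (P : ∀ N, Measure (X N)) (μ : ∀ N, Measure (Y N))
      (gX : ∀ N, X N → ℝ × EuclideanSpace ℝ (Fin 3) × ℝ) (gY : ∀ N, Y N → ℝ × EuclideanSpace ℝ (Fin 3) × ℝ),
      (∀ F : ℝ × EuclideanSpace ℝ (Fin 3) × ℝ → ℝ, LipschitzWith 1 F → (∀ y, |F y| ≤ 1) →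
        Tendsto (fun N => (∫ x, F (gX N x) ∂P N) - ∫ y, F (gY N y) ∂μ N) atTop (𝓝 0)) →
      ∀ (dev : ℝ × EuclideanSpace ℝ (Fin 3) × ℝ → ℝ) {δ : ℝ}, 0 < δ → (∀ a b, |dev a - dev b| ≤ dist a b) →
      (∀ N, IsFiniteMeasure (P N)) → (∀ N, IsFiniteMeasure (μ N)) → (∀ N, Measurable fun x => dev (gX N x)) →
      Tendsto (fun N => μ N {y | δ / 2 < dev (gY N y)}) atTop (𝓝 0) →
      Tendsto (fun N => P N {x | δ < dev (gX N x)}) atTop (𝓝 0) := by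
    intro X Y _ _ P μ gX gY hH dev δ hδ hdev hP hμ hmeas hB
    have hm0 : 0 < min 1 (δ / 2) := lt_min one_pos (half_pos hδ)
    have hG0 : ∀ r : ℝ, 0 ≤ min 1 (max 0 (r - δ / 2)) := fun r => le_min zero_le_one (le_max_left _ _)
    have hG1 : ∀ r : ℝ, min 1 (max 0 (r - δ / 2)) ≤ 1 := fun r => min_le_left _ _
    have hGm : ∀ r : ℝ, δ < r → min 1 (δ / 2) ≤ min 1 (max 0 (r - δ / 2)) := fun r hr =>
      min_le_min le_rfl ((by linarith : δ / 2 ≤ r - δ / 2).trans (le_max_right _ _))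
    have hGz : ∀ r : ℝ, r ≤ δ / 2 → min 1 (max 0 (r - δ / 2)) = 0 := fun r hr => by
      rw [max_eq_left (by linarith), min_eq_right (zero_le_one' ℝ)]
    have hA := hH (fun y => min 1 (max 0 (dev y - δ / 2))) (LipschitzWith.of_dist_le_mul fun a b => by
        rw [NNReal.coe_one, one_mul, Real.dist_eq]
        calc |min 1 (max 0 (dev a - δ / 2)) - min 1 (max 0 (dev b - δ / 2))|
            ≤ |max 0 (dev a - δ / 2) - max 0 (dev b - δ / 2)| :=
              (abs_min_sub_min_le_max _ _ _ _).trans (by rw [sub_self, abs_zero, max_eq_right (abs_nonneg _)])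
          _ ≤ |(dev a - δ / 2) - (dev b - δ / 2)| :=
              (abs_max_sub_max_le_max _ _ _ _).trans (by rw [sub_self, abs_zero, max_eq_right (abs_nonneg _)])
          _ = |dev a - dev b| := by rw [sub_sub_sub_cancel_right]
          _ ≤ dist a b := hdev a b)
      (fun y => by rw [abs_of_nonneg (hG0 _)]; exact hG1 _)
    have hlow : ∀ N, min 1 (δ / 2) * (P N {x | δ < dev (gX N x)}).toReal ≤
        ∫ x, min 1 (max 0 (dev (gX N x) - δ / 2)) ∂P N := by
      intro N
      haveI := hP N
      have hE : MeasurableSet {x | δ < dev (gX N x)} := measurableSet_lt measurable_const (hmeas N)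
      have hint : Integrable (fun x => min 1 (max 0 (dev (gX N x) - δ / 2))) (P N) := by
        refine Integrable.mono' (integrable_const (1 : ℝ)) ?_ (Eventually.of_forall fun x => ?_)
        · exact ((continuous_const.min (continuous_const.max (continuous_id.sub continuous_const))).measurable.comp
            (hmeas N)).aestronglyMeasurable
        · rw [Real.norm_eq_abs, abs_of_nonneg (hG0 _)]; exact hG1 _
      have hind : ∫ x, {x | δ < dev (gX N x)}.indicator (fun _ => min 1 (δ / 2)) x ∂P N =
          min 1 (δ / 2) * (P N {x | δ < dev (gX N x)}).toReal := by
        rw [integral_indicator_const _ hE, smul_eq_mul, measureReal_def, mul_comm]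
      rw [← hind]
      refine integral_mono ((integrable_const _).indicator hE) hint fun x => ?_
      by_cases hx : x ∈ {x | δ < dev (gX N x)}
      · rw [Set.indicator_of_mem hx]; exact hGm _ hx
      · rw [Set.indicator_of_notMem hx]; exact hG0 _
    have hup : ∀ N, ∫ y, min 1 (max 0 (dev (gY N y) - δ / 2)) ∂μ N ≤ (μ N {y | δ / 2 < dev (gY N y)}).toReal := by
      intro N
      haveI := hμ N
      by_cases hint : Integrable (fun y => min 1 (max 0 (dev (gY N y) - δ / 2))) (μ N)
      · rw [integral_eq_lintegral_of_nonneg_ae (Eventually.of_forall fun y => hG0 _) hint.aestronglyMeasurable]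
        refine ENNReal.toReal_mono (measure_ne_top _ _) ?_
        calc ∫⁻ y, ENNReal.ofReal (min 1 (max 0 (dev (gY N y) - δ / 2))) ∂μ N
            ≤ ∫⁻ y, {y | δ / 2 < dev (gY N y)}.indicator (fun _ => (1 : ENNReal)) y ∂μ N :=
              lintegral_mono fun y => ?_
          _ ≤ ∫⁻ y in {y | δ / 2 < dev (gY N y)}, (fun _ => (1 : ENNReal)) y ∂μ N := lintegral_indicator_le _ _
          _ = μ N {y | δ / 2 < dev (gY N y)} := setLIntegral_one _
        by_cases hy : y ∈ {y | δ / 2 < dev (gY N y)}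
        · rw [Set.indicator_of_mem hy]; exact ENNReal.ofReal_le_one.2 (hG1 _)
        · rw [Set.indicator_of_notMem hy]
          simp only [Set.mem_setOf_eq, not_lt] at hy
          rw [hGz _ hy, ENNReal.ofReal_zero]
      · rw [integral_undef hint]; exact ENNReal.toReal_nonneg
    have hBr : Tendsto (fun N => (μ N {y | δ / 2 < dev (gY N y)}).toReal) atTop (𝓝 0) := by
      simpa [Function.comp_def] using (ENNReal.tendsto_toReal ENNReal.zero_ne_top).comp hB
    have hreal : Tendsto (fun N => (P N {x | δ < dev (gX N x)}).toReal) atTop (𝓝 0) := by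
      refine squeeze_zero (fun N => ENNReal.toReal_nonneg) (fun N => ?_)
        (by simpa using (hA.abs.add hBr).div_const (min 1 (δ / 2)))
      rw [le_div_iff₀ hm0, mul_comm]
      calc min 1 (δ / 2) * (P N {x | δ < dev (gX N x)}).toReal
          ≤ ∫ x, min 1 (max 0 (dev (gX N x) - δ / 2)) ∂P N := hlow N
        _ = ((∫ x, min 1 (max 0 (dev (gX N x) - δ / 2)) ∂P N) - ∫ y, min 1 (max 0 (dev (gY N y) - δ / 2)) ∂μ N) +
              ∫ y, min 1 (max 0 (dev (gY N y) - δ / 2)) ∂μ N := by ring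
        _ ≤ _ := add_le_add (le_abs_self _) (hup N)
    have hne : ∀ N, P N {x | δ < dev (gX N x)} ≠ ⊤ := fun N => by haveI := hP N; exact measure_ne_top _ _
    exact (ENNReal.tendsto_toReal_iff hne ENNReal.zero_ne_top).1 (by simpa using hreal)
  have hdD : ∀ (c : ℝ) (a b : ℝ × EuclideanSpace ℝ (Fin 3) × ℝ), |(|a.1 - c|) - (|b.1 - c|)| ≤ dist a b :=
    fun c a b => calc |(|a.1 - c|) - (|b.1 - c|)| ≤ |(a.1 - c) - (b.1 - c)| := abs_abs_sub_abs_le_abs_sub _ _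
      _ = dist a.1 b.1 := by rw [sub_sub_sub_cancel_right, Real.dist_eq]
      _ ≤ dist a b := (le_max_left _ _).trans_eq Prod.dist_eq.symm
  have hdM : ∀ (c : EuclideanSpace ℝ (Fin 3)) (a b : ℝ × EuclideanSpace ℝ (Fin 3) × ℝ),
      |‖a.2.1 - c‖ - ‖b.2.1 - c‖| ≤ dist a b :=
    fun c a b => calc |‖a.2.1 - c‖ - ‖b.2.1 - c‖| ≤ ‖(a.2.1 - c) - (b.2.1 - c)‖ := abs_norm_sub_norm_le _ _
      _ = dist a.2.1 b.2.1 := by rw [sub_sub_sub_cancel_right, dist_eq_norm]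
      _ ≤ dist a.2 b.2 := (le_max_left _ _).trans_eq Prod.dist_eq.symm
      _ ≤ dist a b := (le_max_right _ _).trans_eq Prod.dist_eq.symm
  have hdE : ∀ (c : ℝ) (a b : ℝ × EuclideanSpace ℝ (Fin 3) × ℝ), |(|a.2.2 - c|) - (|b.2.2 - c|)| ≤ dist a b :=
    fun c a b => calc |(|a.2.2 - c|) - (|b.2.2 - c|)| ≤ |(a.2.2 - c) - (b.2.2 - c)| := abs_abs_sub_abs_le_abs_sub _ _
      _ = dist a.2.2 b.2.2 := by rw [sub_sub_sub_cancel_right, Real.dist_eq]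
      _ ≤ dist a.2 b.2 := (le_max_right _ _).trans_eq Prod.dist_eq.symm
      _ ≤ dist a b := (le_max_right _ _).trans_eq Prod.dist_eq.symm
  have hpos : ∀ (n : ℕ) (i : Fin n), Measurable fun z : Literature.Analysis.FluidPDE.Config n (Fin 3) (UnitAddTorus (Fin 3)) => (z i).1 :=
    fun n i => (measurable_pi_apply i).fst
  have hvel : ∀ (n : ℕ) (i : Fin n), Measurable fun z : Literature.Analysis.FluidPDE.Config n (Fin 3) (UnitAddTorus (Fin 3)) => (z i).2 :=
    fun n i => (measurable_pi_apply i).snd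
  have hmD : ∀ (n : ℕ) (χ : UnitAddTorus (Fin 3) → ℝ), Continuous χ →
      Measurable fun z : Literature.Analysis.FluidPDE.Config n (Fin 3) (UnitAddTorus (Fin 3)) => Literature.MathematicalPhysics.KineticTheory.empiricalDensityField z χ := by
    intro n χ hχ
    simp_rw [Literature.MathematicalPhysics.KineticTheory.empiricalDensityField_eq_sum]
    exact measurable_const.mul (Finset.measurable_sum _ fun i _ => hχ.measurable.comp (hpos n i))
  have hmM : ∀ (n : ℕ) (χ : UnitAddTorus (Fin 3) → ℝ), Continuous χ →
      Measurable fun z : Literature.Analysis.FluidPDE.Config n (Fin 3) (UnitAddTorus (Fin 3)) => Literature.MathematicalPhysics.KineticTheory.empiricalMomentumField z χ := by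
    intro n χ hχ
    simp_rw [Literature.MathematicalPhysics.KineticTheory.empiricalMomentumField_eq_sum]
    exact (Finset.measurable_sum _ fun i _ => (hχ.measurable.comp (hpos n i)).smul (hvel n i)).const_smul ((n : ℝ)⁻¹)
  have hmE : ∀ (n : ℕ) (χ : UnitAddTorus (Fin 3) → ℝ), Continuous χ →
      Measurable fun z : Literature.Analysis.FluidPDE.Config n (Fin 3) (UnitAddTorus (Fin 3)) => Literature.MathematicalPhysics.KineticTheory.empiricalEnergyField z χ := by
    intro n χ hχ
    simp_rw [Literature.MathematicalPhysics.KineticTheory.empiricalEnergyField_eq_sum]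
    exact measurable_const.mul (Finset.measurable_sum _ fun i _ =>
      (hχ.measurable.comp (hpos n i)).mul (((hvel n i).norm.pow_const 2).div_const 2))
  have hq_mem : ∀ N : ℕ, ((N : ℝ) + 1) ^ (-(1 / 6 : ℝ)) ∈ unitInterval := fun N =>
    ⟨Real.rpow_nonneg (by positivity) _,
      Real.rpow_le_one_of_one_le_of_nonpos (by have := Nat.cast_nonneg (α := ℝ) N; linarith) (by norm_num)⟩
  let q : ℕ → unitInterval := fun N => ⟨((N : ℝ) + 1) ^ (-(1 / 6 : ℝ)), hq_mem N⟩
  have hN1 : Tendsto (fun N : ℕ => (N : ℝ) + 1) atTop atTop := tendsto_natCast_atTop_atTop.atTop_add tendsto_const_nhds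
  have hq0 : Tendsto (fun N => (q N : ℝ)) atTop (𝓝 0) := (tendsto_rpow_neg_atTop (by norm_num : (0 : ℝ) < 1 / 6)).comp hN1
  have hq1 : Tendsto (fun N : ℕ => (q N : ℝ) * ((N : ℝ) + 1) ^ (1 / 3 : ℝ)) atTop atTop := by
    refine ((tendsto_rpow_atTop (by norm_num : (0 : ℝ) < 1 / 6)).comp hN1).congr fun N => ?_
    show ((N : ℝ) + 1) ^ (1 / 6 : ℝ) = ((N : ℝ) + 1) ^ (-(1 / 6 : ℝ)) * ((N : ℝ) + 1) ^ (1 / 3 : ℝ)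
    rw [← Real.rpow_add (by positivity : (0 : ℝ) < (N : ℝ) + 1)]
    norm_num
  intro a₀ θ₀ u₀ ha hθ hu ha0 hθ0
  obtain ⟨σ₁, hσ₁, H₁⟩ := h₁ a₀ θ₀ u₀ ha hθ hu ha0 hθ0
  obtain ⟨σ₂, hσ₂, H₂⟩ := h₂ q hq0 hq1 a₀ θ₀ u₀ ha hθ hu ha0 hθ0
  refine ⟨min (min σ₁ σ₂) (1 / 2), by positivity, ?_⟩
  intro σ hσ hσlt T ρ θ u hsol Φ h0 t ht
  have hσ₁' : σ < σ₁ := lt_of_lt_of_le hσlt ((min_le_left _ _).trans (min_le_left _ _))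
  have hσ₂' : σ < σ₂ := lt_of_lt_of_le hσlt ((min_le_left _ _).trans (min_le_right _ _))
  have hPfin : ∀ N, IsFiniteMeasure (Literature.MathematicalPhysics.KineticTheory.localGibbsLaw σ a₀ u₀ θ₀ N (Φ N)) := fun N => by
    haveI := Literature.MathematicalPhysics.KineticTheory.isProbabilityMeasure_localGibbsLaw ha hθ hu ha0 hθ0 (lt_of_lt_of_le hσlt (min_le_right _ _)).le N (Φ N)
    infer_instance
  specialize H₁ σ hσ hσ₁' T ρ θ u hsol Φ h0 t ht
  specialize H₂ σ hσ hσ₂' T ρ θ u hsol Φ h0 t ht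
  intro χ hχ δ hδ
  refine ⟨?_, ?_, ?_⟩
  · have hres := key _ _ _ _ (fun F hF hF1 => H₁ χ hχ F hF hF1 q hq0) (fun y => |y.1 - ∫ x, χ x * ρ t x|) hδ (hdD _)
      hPfin (fun N => by dsimp only; infer_instance)
      (fun N => by exact continuous_abs.measurable.comp (((hmD (N + 1) χ hχ).comp ((Φ N).measurable_flow t)).sub measurable_const))
      (H₂ χ hχ (δ / 2) (half_pos hδ)).1
    exact hres
  · have hres := key _ _ _ _ (fun F hF hF1 => H₁ χ hχ F hF hF1 q hq0) (fun y => ‖y.2.1 - ∫ x, (χ x * ρ t x) • u t x‖) hδ (hdM _)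
      hPfin (fun N => by dsimp only; infer_instance)
      (fun N => by exact (((hmM (N + 1) χ hχ).comp ((Φ N).measurable_flow t)).sub measurable_const).norm)
      (H₂ χ hχ (δ / 2) (half_pos hδ)).2.1
    exact hres
  · have hres := key _ _ _ _ (fun F hF hF1 => H₁ χ hχ F hF hF1 q hq0)
      (fun y => |y.2.2 - ∫ x, χ x * Literature.MathematicalPhysics.KineticTheory.totalEnergyDensity (ρ t x) (u t x) (θ t x)|) hδ (hdE _)
      hPfin (fun N => by dsimp only; infer_instance)
      (fun N => by exact continuous_abs.measurable.comp (((hmE (N + 1) χ hχ).comp ((Φ N).measurable_flow t)).sub measurable_const))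
      (H₂ χ hχ (δ / 2) (half_pos hδ)).2.2
    exact hres

/-! ## §3 The compositions (kernel-checked; conclude the crux BY NAME) -/

/-- **The line's composition**: `DiceContinuity → RareDiceEuler → LambertianEuler → SwapGap`, through the unguarded conjunct
(§2) and the landed `Theorems.swapGap_of_hydrodynamicLimit` / `Theorems.localGibbsProbability_proof`. -/
theorem SwapGap_of :
    VanishingNoise.DiceContinuity → VanishingNoise.RareDiceEuler → LambertianContactSwap.LambertianEuler →
      Summit.AtomisticToContinuum.HydrodynamicLimit.Theses.LambertianContactSwap.SwapGap :=
  fun hD hR hL =>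
    Summit.AtomisticToContinuum.HydrodynamicLimit.Theorems.swapGap_of_hydrodynamicLimit
      Summit.AtomisticToContinuum.HydrodynamicLimit.Theorems.localGibbsProbability_proof hL
      (hydrodynamicLimit_unguarded_of_dice hD hR)

/-- **The crux modulo the three stubs.** -/
theorem swapGap_of_stubs : Summit.AtomisticToContinuum.HydrodynamicLimit.Theses.LambertianContactSwap.SwapGap :=
  SwapGap_of stub_diceContinuity stub_rareDiceEuler stub_lambertianEuler

/-- **The shared item's other copy** (route `LindebergRandomFuture` declares `SwapGap` with the byte-identical `let` block). -/
theorem SwapGap_proof : Summit.AtomisticToContinuum.HydrodynamicLimit.Theses.LindebergRandomFuture.SwapGap :=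
  swapGap_of_stubs

end Summit.AtomisticToContinuum.HydrodynamicLimit.Cruxes.SwapGap.DiceTransfer
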